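import Literature.Algebra.Homology.CharpolyHomologySequence
import Literature.Algebra.Homology.EulerPoincarePrinciple
import Literature.Algebra.Homology.CharpolyEulerPoincare
import Literature.Algebra.Homology.LefschetzNumberHomologyShortExact
import HarnessLib

/-!
# Characteristic polynomials on homology are multiplicative along a short exact sequence of complexes (LEAF 2 of 2)

Layer `Literature/Algebra/Homology` (pure linear algebra over Mathlib; proved theorems only, 0 definitions, 0 named facts, no instances,
no notation). For a short exact sequence `S : 0 → X₁ → X₂ → X₃ → 0` of homological complexes of vector spaces over a field `K` (any shape `c`
with `EulerCharSigns`), an endomorphism `τ : S ⟶ S`, and finite-dimensional, finitely supported homology, write `χ(u) ∈ K[X]` for a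
characteristic polynomial and `χ(i) = ±1` for the sign. Then, in the rational function field `RatFunc K`,

  **`finprod_charpoly_homologyMap_X₂_eq : ∏ᶠ i, χ(Hᵢ(τ₂))^{χ(i)} = (∏ᶠ i, χ(Hᵢ(τ₁))^{χ(i)}) · ∏ᶠ i, χ(Hᵢ(τ₃))^{χ(i)}`**

— the linear algebra of "zeta functions are multiplicative in short exact sequences" (Lang XX §3; Bourbaki VIII §20 n°6): row
`EulerPoincarePrinciple`'s `finprod_zpow_χ_eq_of_degreewise` (BY NAME) in the group `(RatFunc K)ˣ`, fed degreewise by LEAF 1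
(`CharpolyHomologySequence`), the connecting-map factors cancelling in pairs `i ↔ next i`; plus `coe_finprod_units_zpow`. Rows `TraceHomologySequence` /
`LefschetzNumberHomologyShortExact` (the `nextCoeff` shadows) are NOT restated or re-derived. Library only (cell `pub-hodge-ring2`, count-neutral).

## References

* S. Lang, *Algebra* (2002), Ch. XX §3, Thm. 3.1 (Euler–Poincaré maps). [Lang2002]
* N. Bourbaki, *Algèbre, Chapitre VIII* (2012), §20 n°6, p. 377. [BourbakiAlgebreVIII2012]
-/

open CategoryTheory CategoryTheory.Limits Polynomial

universe v u w

namespace Literature.Algebra.Homology.HopfTrace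

variable {K : Type u} [Field K]

/-- Reading a finite product of powers of units in the ambient commutative division monoid. [cite: Lang2002, Ch. XX §3] -/
theorem coe_finprod_units_zpow {M : Type*} [DivisionCommMonoid M] {α : Type*} (u : α → Mˣ) (n : α → ℤ) (hu : u.HasFiniteMulSupport) :
    (((∏ᶠ i, u i ^ n i : Mˣ)) : M) = ∏ᶠ i, (u i : M) ^ n i := by
  have hfs : (fun i => u i ^ n i).HasFiniteMulSupport := hu.subset fun i hi => by
    simp only [Function.mem_mulSupport, ne_eq] at hi ⊢
    exact fun h1 => hi (by rw [h1, one_zpow])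
  rw [← Units.coeHom_apply, MonoidHom.map_finprod _ hfs]
  exact finprod_congr fun i => by rw [map_zpow, Units.coeHom_apply]

variable {ι : Type w} {c : ComplexShape ι} {S : ShortComplex (HomologicalComplex (ModuleCat.{v} K) c)} (hS : S.ShortExact) (τ : S ⟶ S)
include hS

/-- **Characteristic polynomials on homology are multiplicative along a short exact sequence of complexes with an endomorphism**:
`∏ᶠ i, χ(Hᵢ(τ₂))^{χ(i)} = (∏ᶠ i, χ(Hᵢ(τ₁))^{χ(i)}) · ∏ᶠ i, χ(Hᵢ(τ₃))^{χ(i)}` in `RatFunc K` (finite-dimensional finitely supported homology of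
`X₁`, `X₃`; the instance `Module.Finite K (S.X₂.homology i)` is row `HomologyEulerCharacteristicShortExact`'s `moduleFinite_homology_X₂ hS i`).
[cite: Lang2002, Ch. XX §3, Thm. 3.1] [cite: BourbakiAlgebreVIII2012, VIII §20 n°6 (p. 377)] -/
theorem finprod_charpoly_homologyMap_X₂_eq [c.EulerCharSigns] [∀ i, Module.Finite K (S.X₁.homology i)]
    [∀ i, Module.Finite K (S.X₂.homology i)] [∀ i, Module.Finite K (S.X₃.homology i)]
    (h₁ : (GradedObject.finrankSupport fun i => S.X₁.homology i).Finite) (h₃ : (GradedObject.finrankSupport fun i => S.X₃.homology i).Finite) :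
    ∏ᶠ i, algebraMap K[X] (RatFunc K) (HomologicalComplex.homologyMap τ.τ₂ i).hom.charpoly ^ ((c.χ i : ℤ)) =
      (∏ᶠ i, algebraMap K[X] (RatFunc K) (HomologicalComplex.homologyMap τ.τ₁ i).hom.charpoly ^ ((c.χ i : ℤ))) *
        ∏ᶠ i, algebraMap K[X] (RatFunc K) (HomologicalComplex.homologyMap τ.τ₃ i).hom.charpoly ^ ((c.χ i : ℤ)) := by
  classical
  -- the unit of `K(X)` attached to a characteristic polynomial
  have hρ : ∀ {M : Type v} [AddCommGroup M] [Module K M] [Module.Finite K M] (f : M →ₗ[K] M),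
      algebraMap K[X] (RatFunc K) f.charpoly ≠ 0 := fun f =>
    (map_ne_zero_iff _ (RatFunc.algebraMap_injective K)).2 f.charpoly_monic.ne_zero
  let U : ∀ {M : Type v} [AddCommGroup M] [Module K M] [Module.Finite K M], (M →ₗ[K] M) → (RatFunc K)ˣ :=
    fun f => Units.mk0 _ (hρ f)
  have hU : ∀ {M : Type v} [AddCommGroup M] [Module K M] [Module.Finite K M] (f : M →ₗ[K] M),
      ((U f : (RatFunc K)ˣ) : RatFunc K) = algebraMap K[X] (RatFunc K) f.charpoly := fun f => rfl
  have hUe : ∀ {M N : Type v} [AddCommGroup M] [Module K M] [Module.Finite K M] [AddCommGroup N] [Module K N] [Module.Finite K N]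
      (f : M →ₗ[K] M) (g : N →ₗ[K] N), f.charpoly = g.charpoly → U f = U g := fun f g h => Units.ext (by rw [hU, hU, h])
  have hUm : ∀ {M N P : Type v} [AddCommGroup M] [Module K M] [Module.Finite K M] [AddCommGroup N] [Module K N] [Module.Finite K N]
      [AddCommGroup P] [Module K P] [Module.Finite K P] (f : M →ₗ[K] M) (g : N →ₗ[K] N) (k : P →ₗ[K] P),
      f.charpoly = g.charpoly * k.charpoly → U f = U g * U k := fun f g k h => Units.ext (by rw [Units.val_mul, hU, hU, hU, h, map_mul])
  have hU1 : ∀ {M : Type v} [AddCommGroup M] [Module K M] [Module.Finite K M] (f : M →ₗ[K] M), Subsingleton M → U f = 1 :=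
    fun f _ => Units.ext (by rw [hU, charpoly_eq_one_of_subsingleton, map_one, Units.val_one])
  -- connecting-map factors `χ(H(τ₁) | im δ)`, read at the source (`a`) and at the target (`b`) of `δ`
  let a : ι → (RatFunc K)ˣ := fun i => if h : c.Rel i (c.next i) then
    U ((HomologicalComplex.homologyMap τ.τ₁ (c.next i)).hom.restrict (mapsTo_range_δ hS τ i (c.next i) h)) else 1
  let b : ι → (RatFunc K)ˣ := fun j => if h : c.Rel (c.prev j) j then
    U ((HomologicalComplex.homologyMap τ.τ₁ j).hom.restrict (mapsTo_range_δ hS τ (c.prev j) j h)) else 1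
  -- finite supports: every factor is `1` where the homology space vanishes
  have hs : ∀ (X : HomologicalComplex (ModuleCat.{v} K) c) [∀ i, Module.Finite K (X.homology i)] (φ : X ⟶ X),
      (GradedObject.finrankSupport fun i => X.homology i).Finite →
        (fun i => U (HomologicalComplex.homologyMap φ i).hom).HasFiniteMulSupport := fun X _ φ hX =>
    hX.subset fun i hi => by
      by_contra hni
      haveI : Subsingleton (X.homology i) := Module.finrank_zero_iff.1 (by simpa [GradedObject.finrankSupport] using hni)
      exact hi (hU1 _ ‹_›)
  have s₁ := hs S.X₁ τ.τ₁ h₁; have s₃ := hs S.X₃ τ.τ₃ h₃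
  have s₂ := hs S.X₂ τ.τ₂ ((h₁.union h₃).subset (EulerCharShortExact.finrankSupport_homology_X₂_subset hS))
  have key := finprod_zpow_χ_eq_of_degreewise (c := c)
    (fun i => U (HomologicalComplex.homologyMap τ.τ₁ i).hom * U (HomologicalComplex.homologyMap τ.τ₃ i).hom)
    (fun i => U (HomologicalComplex.homologyMap τ.τ₂ i).hom) a b
    (fun i => by
      -- degreewise: `χ(Hτ₁)·χ(Hτ₃) = χ(Hτ₂)·(a·b)` from LEAF 1 (+ the boundary degrees)
      have e₁ : U (HomologicalComplex.homologyMap τ.τ₁ i).hom =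
          U ((HomologicalComplex.homologyMap τ.τ₂ i).hom.restrict (mapsTo_range_homologyMap_f τ i)) * b i := by
        by_cases hp : c.Rel (c.prev i) i
        · simp only [b, dif_pos hp]; exact hUm _ _ _ (charpoly_homologyMap_τ₁_eq_of_rel hS τ _ _ hp)
        · simp only [b, dif_neg hp, mul_one]; exact hUe _ _ (charpoly_restrict_range_homologyMap_f_eq hS τ i hp).symm
      have e₃ : U (HomologicalComplex.homologyMap τ.τ₃ i).hom =
          a i * U ((HomologicalComplex.homologyMap τ.τ₃ i).hom.restrict (mapsTo_range_homologyMap_g τ i)) := by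
        by_cases hn : c.Rel i (c.next i)
        · simp only [a, dif_pos hn]; exact hUm _ _ _ (charpoly_homologyMap_τ₃_eq_of_rel hS τ _ _ hn)
        · simp only [a, dif_neg hn, one_mul]; exact hUe _ _ (charpoly_restrict_range_homologyMap_g_eq hS τ i hn).symm
      rw [e₁, e₃, hUm _ _ _ (charpoly_homologyMap_τ₂_eq hS τ i)]
      exact Units.ext (by simp only [Units.val_mul]; ring))
    (fun j hj => by simp only [b, dif_neg hj]) (fun i hi => by simp only [a, dif_neg hi])
    (fun i j hij => by
      have h1 : c.prev j = i := c.prev_eq' hij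
      have h2 : c.next i = j := c.next_eq' hij
      subst h1
      simp only [a, b]
      rw [h2])
    s₂
    (h₃.subset fun i hi => by
      by_contra hni
      haveI : Subsingleton (S.X₃.homology i) := Module.finrank_zero_iff.1 (by simpa [GradedObject.finrankSupport] using hni)
      refine hi ?_
      by_cases h : c.Rel i (c.next i)
      · haveI := Lefschetz.subsingleton_range_of_subsingleton (K := K) (hS.δ i (c.next i) h).hom; simp only [a, dif_pos h, hU1 _ ‹_›]
      · simp only [a, dif_neg h])
    (h₁.subset fun j hj => by
      by_contra hnj
      haveI : Subsingleton (S.X₁.homology j) := Module.finrank_zero_iff.1 (by simpa [GradedObject.finrankSupport] using hnj)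
      refine hj ?_
      by_cases h : c.Rel (c.prev j) j
      · simp only [b, dif_pos h, hU1 _ inferInstance]
      · simp only [b, dif_neg h])
  -- read the units identity in `RatFunc K`
  have sz : ∀ {g : ι → (RatFunc K)ˣ}, g.HasFiniteMulSupport → (fun i => g i ^ ((c.χ i : ℤ))).HasFiniteMulSupport := fun {g} hg =>
    hg.subset fun i hi => by simp only [Function.mem_mulSupport, ne_eq] at hi ⊢; exact fun h => hi (by rw [h, one_zpow])
  have split : ∏ᶠ i, (U (HomologicalComplex.homologyMap τ.τ₁ i).hom * U (HomologicalComplex.homologyMap τ.τ₃ i).hom) ^ ((c.χ i : ℤ)) =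
      (∏ᶠ i, U (HomologicalComplex.homologyMap τ.τ₁ i).hom ^ ((c.χ i : ℤ))) *
        ∏ᶠ i, U (HomologicalComplex.homologyMap τ.τ₃ i).hom ^ ((c.χ i : ℤ)) := by
    rw [← finprod_mul_distrib (sz s₁) (sz s₃)]
    exact finprod_congr fun i => mul_zpow _ _ _
  simpa only [Units.val_mul, coe_finprod_units_zpow _ _ s₁, coe_finprod_units_zpow _ _ s₂, coe_finprod_units_zpow _ _ s₃, hU] using
    congrArg (fun x : (RatFunc K)ˣ => (x : RatFunc K)) (key.symm.trans split)

end Literature.Algebra.Homology.HopfTrace
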